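import Mathlib
import Literature.MathematicalPhysics.StatisticalMechanics.LennardJonesClusters

/-!
# Good-set energy budget for separated Lennard-Jones configurations

Bookkeeping for the stacking-hinge line of the priced link census (the "good-set budget" in the
trivial direction). If a configuration `y` of `N` particles in `ℝ³` is `δ₀`-separated and has
Lennard-Jones energy `𝓔_N(y) ≤ N (e + η)`, then for every set `G` of particles

`∑_{i ∈ G} (½ 𝓔ⁱ(y) - e) ≤ η N + (C + |e|) · #Gᶜ`,

with a constant `C = C(δ₀) = (125/6) δ₀⁻⁶ ≥ 0`. Indeed `2 𝓔_N = ∑ᵢ 𝓔ⁱ`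
(`two_mul_interactionEnergy`), the repulsive part of the potential is nonnegative, and the shell
sum `sum_inv_pow_six_le` bounds the attractive part of every site energy, whence the floor
`½ 𝓔ⁱ(y) ≥ -C`; the rest is the identity `#G + #Gᶜ = N`.
-/

namespace Summit.AtomisticToContinuum.Crystallization.Theorems.PricedHcpWindowsBudget

open Filter Topology
open Literature.MathematicalPhysics.StatisticalMechanics

/-- Pure bookkeeping: if `a i ≥ -C` for all `i` and `∑ᵢ a i ≤ N (e + η)`, then for every `G`,
`∑_{i ∈ G} (a i - e) ≤ η N + (C + |e|) · #Gᶜ` (split the full sum over `G` and `Gᶜ` and use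
`#G + #Gᶜ = N`). [folklore] -/
theorem sum_sub_le_of_floor {N : ℕ} (a : Fin N → ℝ) {C e η : ℝ} (G : Finset (Fin N))
    (hfloor : ∀ i, -C ≤ a i) (hsum : ∑ i, a i ≤ (N : ℝ) * (e + η)) :
    ∑ i ∈ G, (a i - e) ≤ η * N + (C + |e|) * ((Gᶜ).card : ℝ) := by
  have hcompl : -(C * ((Gᶜ).card : ℝ)) ≤ ∑ i ∈ Gᶜ, a i := by
    have h := Finset.card_nsmul_le_sum Gᶜ a (-C) fun i _ => hfloor i
    rw [nsmul_eq_mul] at h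
    linarith
  have hsplit : ∑ i ∈ G, a i + ∑ i ∈ Gᶜ, a i = ∑ i, a i := Finset.sum_add_sum_compl G a
  have hcard : (G.card : ℝ) + ((Gᶜ).card : ℝ) = N := by
    have h := Finset.card_add_card_compl G
    rw [Fintype.card_fin] at h
    exact_mod_cast h
  have he : ((Gᶜ).card : ℝ) * e ≤ ((Gᶜ).card : ℝ) * |e| :=
    mul_le_mul_of_nonneg_left (le_abs_self e) (Nat.cast_nonneg _)
  rw [Finset.sum_sub_distrib, Finset.sum_const, nsmul_eq_mul]
  rw [← hcard] at hsum ⊢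
  linarith

/-- **Good-set energy budget.** For every `δ₀ > 0` there is `C ≥ 0` (namely `C = (125/6) δ₀⁻⁶`)
such that every `δ₀`-separated configuration `y` of `N` particles in `ℝ³` with Lennard-Jones
energy `𝓔_N(y) ≤ N (e + η)` satisfies, for every set `G` of particles,
`∑_{i ∈ G} (½ 𝓔ⁱ(y) - e) ≤ η N + (C + |e|) · #Gᶜ`. The constant comes from the site-energy
floor `𝓔ⁱ(y) ≥ -(1/6) ∑_{k ≠ i} |yᵢ - y_k|⁻⁶ ≥ -(250/6) δ₀⁻⁶` (shell sum). [folklore] -/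
theorem stub_goodEnergyBudget : ∀ δ₀ : ℝ, 0 < δ₀ → ∃ C : ℝ, 0 ≤ C ∧ ∀ (N : ℕ) (y : Fin N → EuclideanSpace ℝ (Fin 3)), (∀ i j : Fin N, i ≠ j → δ₀ ≤ dist (y i) (y j)) → ∀ (e η : ℝ) (G : Finset (Fin N)), Literature.MathematicalPhysics.StatisticalMechanics.interactionEnergy Literature.MathematicalPhysics.StatisticalMechanics.lennardJones y ≤ (N : ℝ) * (e + η) → ∑ i ∈ G, ((1 / 2 : ℝ) * Literature.MathematicalPhysics.StatisticalMechanics.siteEnergy Literature.MathematicalPhysics.StatisticalMechanics.lennardJones y i - e) ≤ η * N + (C + |e|) * ((Gᶜ).card : ℝ) := by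
  intro δ₀ hδ₀
  refine ⟨(125 / 6) * δ₀⁻¹ ^ 6, by positivity, ?_⟩
  intro N y hsep e η G hE
  -- the site-energy floor `½ 𝓔ⁱ(y) ≥ -C`
  have hfloor : ∀ i : Fin N,
      -((125 / 6) * δ₀⁻¹ ^ 6) ≤ (1 / 2 : ℝ) * siteEnergy lennardJones y i := by
    intro i
    have hS := sum_inv_pow_six_le y hδ₀ hsep i
    have hexp : siteEnergy lennardJones y i =
        (1 / 12) * ∑ k ∈ Finset.univ.erase i, (dist (y i) (y k))⁻¹ ^ 12 -
          (1 / 6) * ∑ k ∈ Finset.univ.erase i, (dist (y i) (y k))⁻¹ ^ 6 := by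
      simp only [siteEnergy, lennardJones, Finset.sum_sub_distrib, Finset.mul_sum]
    have h12 : 0 ≤ ∑ k ∈ Finset.univ.erase i, (dist (y i) (y k))⁻¹ ^ 12 :=
      Finset.sum_nonneg fun k _ => by positivity
    rw [hexp]
    linarith
  -- `∑ᵢ ½ 𝓔ⁱ(y) = 𝓔_N(y) ≤ N (e + η)`
  have hsum : ∑ i, (1 / 2 : ℝ) * siteEnergy lennardJones y i ≤ (N : ℝ) * (e + η) := by
    rw [← Finset.mul_sum, ← two_mul_interactionEnergy]
    linarith
  exact sum_sub_le_of_floor (fun i => (1 / 2 : ℝ) * siteEnergy lennardJones y i) G hfloor hsum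

end Summit.AtomisticToContinuum.Crystallization.Theorems.PricedHcpWindowsBudget
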